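import Summits.ValiantsHypothesis.ValiantsHypothesis.Theorems.GrenetZeonTwoDimCoefficientsDualUnipotentDualCharpoly
import Summits.ValiantsHypothesis.ValiantsHypothesis.Theorems.GrenetZeonDualUnipotentThreeHalvesLongMassRankRow

/-!
# `GrenetZeon.DualUnipotentThreeHalves` (stmt-ValiantsHypothesis-24318), line `slow_core`, stub (c) `SlowCore.LongMassSlowLawInv`:
# THE CHAIN SANDWICH — a structural law obeyed by EVERY linear space of nilpotent matrices (the enemy of (c))

The research statement (c) quantifies over all nilpotent affine pencils, i.e. (✓ `longMassSlowLawInv_iff_submodule`) over all linear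
subspaces `V ≤ M_b(ℂ)` of nilpotent matrices, and its open content lives on the NON-triangularisable (irreducible) locus (✓
`longMass_on_triangularisable_locus`).  The cell's kernel knows three laws valid for every such `V`: Gerstenhaber's dimension bound
(✓ `Literature…finrank_le_choose_two`), trace orthogonality (✓ `Literature…trace_mul_eq_zero_of_mem`) and the adapted-vector lemma.  This file
adds the FIRST-ORDER law of Gerstenhaber's 1958 argument and its iterated («chain») form, in the submodule currency of (c) and in pencil currency.

Let `V ≤ M_b(ℂ)` with `X ^ H = 0` for every `X ∈ V` (a uniform index bound; `H = b` always works).  For `A, B, B₁, …, B_q ∈ V`: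

* ★ `powDerivSum_eq_zero_of_forall_pow_eq_zero` — if `(A + t·B)^H = 0` for every `t ∈ ℂ` then `Σ_{i<H} A^i · B · A^{H−1−i} = 0`
  (the `t`-linear term; proof: the polynomial matrix `(A + X·B)^H ∈ M_b(ℂ[X])` vanishes (✓ `Polynomial.funext` entrywise), push it
  along `X ↦ ε` into `M_b(ℂ[ε]/ε²)` and read off the `ε`-part with ✓ `DualCharpoly.dualLift_pow_map_snd`); and
  `pow_eq_zero_of_forall_line_pow_eq_zero` — the top term: `B ^ H = 0`;
* ★ `oneLetter_eq_zero` — hence `Σ_{i<H} A^i B A^{H−1−i} = 0` for all `A, B ∈ V`;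
* ★★ `sandwich_eq_zero` — `A^{H−1} · B · A^{H−1} = 0` (`1 ≤ H`): every `B ∈ V` maps `range A^{H−1}` into `ker A^{H−1}`;
* ★★★ `chain_sandwich_eq_zero` — `A^{H−1} · B · (A^{H−2} B₁) · (A^{H−2} B₂) ⋯ (A^{H−2} B_q) · A^{H−1} = 0` for EVERY list `B₁, …, B_q` of members
  of `V` (induction on `q`: feed the one-letter identity of `B` into the chain; the lower terms die by the induction hypothesis);
* ★★ `sq_zero_space_sandwich` — the case `H = 2`: `A · X · A = 0` for every `X` in the unital algebra `Algebra.adjoin ℂ V` generated by `V`;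
  hence (`eq_zero_of_sq_zero_of_adjoin_eq_top`) a space of square-zero matrices generating `M_b(ℂ)` as an algebra is `{0}` — an «irreducible
  constituent» in the sense of the line (`pencilAlg = ⊤`) never has index `2`;
* ★ `pointMat_sandwich_linMat`, `pointMat_chain_sandwich` — pencil currency: for an affine pencil `N` with `N ^ H = 0` (`1 ≤ H`), at every point
  `x` and along all directions `v, w₁, …, w_q`: `N(x)^{H−1} · lin(v) · (N(x)^{H−2} lin(w₁)) ⋯ (N(x)^{H−2} lin(w_q)) · N(x)^{H−1} = 0`.

WHAT THIS IS FOR (V34 §2/§5, «structural necessities» of a violator family): a (c)-violator is WLOG an irreducible nilpotent space; the chain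
sandwich is a law such a space satisfies at every one of its elements `A`: the orbit of `range A^{H−1}` under the operators `A^{H−2}·B` (`B ∈ V`)
is mapped by every member of `V` into `ker A^{H−1}` — a canonical 2-step partial flag attached to `A` that any violator construction must carry.

HONEST FRAMING.  Support lemmas (`--supports stmt-ValiantsHypothesis-24318`); NOT progress on (c) `SlowCore.LongMassSlowLawInv` (RESEARCH — OPEN);
closes no stub; S3, the crux 24318, 8062 (`stub_dualUnipotent`) and `VP ≠ VNP` are NOT proved.  Def-free, no named facts, no sorry.
[folklore; the first-order identity is the opening step of Gerstenhaber 1958 / Mathes–Omladič–Radjavi 1991]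
-/

set_option linter.dupNamespace false
set_option autoImplicit false

noncomputable section

namespace Summit.ValiantsHypothesis.ValiantsHypothesis.Theorems.GrenetZeon.NilSpaceSandwich

open Matrix Polynomial TrivSqZeroExt
open scoped BigOperators
open Summit.ValiantsHypothesis.ValiantsHypothesis.Cruxes.TwoDimCoefficients.DimTwoCases (AffMat IsAffine)
open Summit.ValiantsHypothesis.ValiantsHypothesis.Cruxes.TwoDimCoefficients.DimTwoCases.DualCharpoly
  (dualLift_pow_map_snd)
open Summit.ValiantsHypothesis.ValiantsHypothesis.Theorems.GrenetZeon.ResolventFlag (pointMat linMat)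
open Summit.ValiantsHypothesis.ValiantsHypothesis.Theorems.GrenetZeon.RankRow (pointMat_eq_pointMat_zero_add_linMat linMap linMap_apply)

variable {b : ℕ}

/-! ## §1 The first-order and the top identities of a nilpotent line -/

/-- The line `A + X·B` as a matrix over `ℂ[X]`, evaluated at `X = t`. -/
theorem evalRingHom_mapMatrix_line (A B : Matrix (Fin b) (Fin b) ℂ) (t : ℂ) :
    (Polynomial.evalRingHom t).mapMatrix (A.map Polynomial.C + (Polynomial.X : ℂ[X]) • B.map Polynomial.C) = A + t • B := by
  refine Matrix.ext fun i j => ?_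
  simpa [Matrix.map_apply] using mul_comm (B i j) t

/-- If `(A + t·B)^H = 0` for every `t ∈ ℂ`, the polynomial matrix `(A + X·B)^H ∈ M_b(ℂ[X])` vanishes. -/
theorem line_pow_eq_zero (A B : Matrix (Fin b) (Fin b) ℂ) (H : ℕ) (h : ∀ t : ℂ, (A + t • B) ^ H = 0) :
    (A.map Polynomial.C + (Polynomial.X : ℂ[X]) • B.map Polynomial.C) ^ H = 0 := by
  set P := A.map Polynomial.C + (Polynomial.X : ℂ[X]) • B.map Polynomial.C with hP
  refine Matrix.ext fun i j => ?_
  rw [Matrix.zero_apply]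
  apply Polynomial.funext
  intro t
  have h1 : (Polynomial.evalRingHom t).mapMatrix (P ^ H) = 0 := by
    rw [map_pow, hP, evalRingHom_mapMatrix_line, h t]
  have h2 := congr_fun (congr_fun h1 i) j
  simpa [Matrix.map_apply] using h2

/-- The line `A + X·B` pushed along `X ↦ ε` is the dual lift `A + ε·B ∈ M_b(ℂ[ε]/ε²)`. -/
theorem aeval_eps_mapMatrix_line (A B : Matrix (Fin b) (Fin b) ℂ) :
    ((Polynomial.aeval (DualNumber.eps : DualNumber ℂ) : ℂ[X] →ₐ[ℂ] DualNumber ℂ) : ℂ[X] →+* DualNumber ℂ).mapMatrix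
        (A.map Polynomial.C + (Polynomial.X : ℂ[X]) • B.map Polynomial.C) =
      A.map (inl : ℂ → DualNumber ℂ) + B.map (inr : ℂ → DualNumber ℂ) := by
  refine Matrix.ext fun i j => ?_
  refine TrivSqZeroExt.ext ?_ ?_
  · simp [Matrix.map_apply, TrivSqZeroExt.algebraMap_eq_inl]
  · simp [Matrix.map_apply, TrivSqZeroExt.algebraMap_eq_inl]

/-- ★ **FIRST-ORDER IDENTITY.**  If `(A + t·B)^H = 0` for every `t ∈ ℂ` then `Σ_{i<H} A^i · B · A^{H−1−i} = 0`. [folklore; Gerstenhaber 1958] -/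
theorem powDerivSum_eq_zero_of_forall_pow_eq_zero (A B : Matrix (Fin b) (Fin b) ℂ) (H : ℕ)
    (h : ∀ t : ℂ, (A + t • B) ^ H = 0) :
    (∑ i ∈ Finset.range H, A ^ i * B * A ^ (H - 1 - i)) = 0 := by
  have h1 := line_pow_eq_zero A B H h
  set φ : ℂ[X] →+* DualNumber ℂ :=
    ((Polynomial.aeval (DualNumber.eps : DualNumber ℂ) : ℂ[X] →ₐ[ℂ] DualNumber ℂ) : ℂ[X] →+* DualNumber ℂ) with hφ
  have h2 : φ.mapMatrix ((A.map Polynomial.C + (Polynomial.X : ℂ[X]) • B.map Polynomial.C) ^ H) = 0 := by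
    rw [h1, map_zero]
  rw [map_pow, hφ, aeval_eps_mapMatrix_line] at h2
  rw [← dualLift_pow_map_snd A B H, h2, Matrix.map_zero _ snd_zero]

/-- ★ **TOP IDENTITY.**  If `(A + t·B)^H = 0` for every `t ∈ ℂ` then `B ^ H = 0` (the polynomial matrix `(X·A + B)^H` vanishes at every
`X = s ≠ 0` by homogeneity, hence identically, hence at `s = 0`). -/
theorem pow_eq_zero_of_forall_line_pow_eq_zero (A B : Matrix (Fin b) (Fin b) ℂ) (H : ℕ)
    (h : ∀ t : ℂ, (A + t • B) ^ H = 0) : B ^ H = 0 := by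
  set Q := (Polynomial.X : ℂ[X]) • A.map Polynomial.C + B.map Polynomial.C with hQ
  have hev : ∀ s : ℂ, (Polynomial.evalRingHom s).mapMatrix Q = s • A + B := by
    intro s
    refine Matrix.ext fun i j => ?_
    simpa [hQ, Matrix.map_apply] using mul_comm (A i j) s
  have hQ0 : Q ^ H = 0 := by
    refine Matrix.ext fun i j => ?_
    rw [Matrix.zero_apply]
    apply Polynomial.eq_zero_of_infinite_isRoot
    refine ((Set.finite_singleton (0 : ℂ)).infinite_compl).mono ?_
    intro s hs
    have hs' : s ≠ 0 := Set.mem_compl_singleton_iff.mp hs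
    rw [Set.mem_setOf_eq, Polynomial.IsRoot.def]
    have h1 : (Polynomial.evalRingHom s).mapMatrix (Q ^ H) = 0 := by
      rw [map_pow, hev s]
      have e : s • A + B = s • (A + s⁻¹ • B) := by
        rw [smul_add, smul_smul, mul_inv_cancel₀ hs', one_smul]
      rw [e, _root_.smul_pow, h, smul_zero]
    have h2 := congr_fun (congr_fun h1 i) j
    simpa [Matrix.map_apply] using h2
  have h3 : (Polynomial.evalRingHom 0).mapMatrix (Q ^ H) = 0 := by rw [hQ0, map_zero]
  rw [map_pow, hev 0, zero_smul, zero_add] at h3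
  exact h3

/-! ## §2 Nilpotent spaces: one-letter identity, sandwich, chain sandwich -/

/-- ★ **ONE-LETTER IDENTITY** for a nilpotent space of uniform index `≤ H`: `Σ_{i<H} A^i B A^{H−1−i} = 0` for all `A, B ∈ V`. -/
theorem oneLetter_eq_zero (V : Submodule ℂ (Matrix (Fin b) (Fin b) ℂ)) {H : ℕ} (hV : ∀ X ∈ V, X ^ H = 0)
    {A B : Matrix (Fin b) (Fin b) ℂ} (hA : A ∈ V) (hB : B ∈ V) :
    (∑ i ∈ Finset.range H, A ^ i * B * A ^ (H - 1 - i)) = 0 :=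
  powDerivSum_eq_zero_of_forall_pow_eq_zero A B H fun t => hV _ (V.add_mem hA (V.smul_mem t hB))

/-- ★★ **SANDWICH** `A^{H−1} · B · A^{H−1} = 0` for all `A, B` in a nilpotent space of uniform index `≤ H` (`1 ≤ H`): every member of `V`
maps `range A^{H−1}` into `ker A^{H−1}`. [folklore; Gerstenhaber 1958] -/
theorem sandwich_eq_zero (V : Submodule ℂ (Matrix (Fin b) (Fin b) ℂ)) {H : ℕ} (hV : ∀ X ∈ V, X ^ H = 0) (hH : 1 ≤ H)
    {A B : Matrix (Fin b) (Fin b) ℂ} (hA : A ∈ V) (hB : B ∈ V) :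
    A ^ (H - 1) * B * A ^ (H - 1) = 0 := by
  have key : (∑ i ∈ Finset.range H, A ^ i * B * A ^ (H - 1 - i)) * A ^ (H - 1) = 0 := by
    rw [oneLetter_eq_zero V hV hA hB, Matrix.zero_mul]
  rw [Finset.sum_mul, Finset.sum_eq_single (H - 1)] at key
  · simpa using key
  · intro i hi hne
    have hi' := Finset.mem_range.mp hi
    have e : H - 1 - i + (H - 1) = H + (H - 2 - i) := by omega
    rw [Matrix.mul_assoc, ← pow_add, e, pow_add, hV A hA, Matrix.zero_mul, Matrix.mul_zero]
  · intro hn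
    exact absurd (Finset.mem_range.mpr (by omega)) hn

/-- ★★★ **CHAIN SANDWICH.**  In a nilpotent space `V` of uniform index `≤ H` (`1 ≤ H`), for `A, B ∈ V` and EVERY list `B₁, …, B_q` of members of `V`:
`A^{H−1} · B · (A^{H−2} B₁) ⋯ (A^{H−2} B_q) · A^{H−1} = 0`. -/
theorem chain_sandwich_eq_zero (V : Submodule ℂ (Matrix (Fin b) (Fin b) ℂ)) {H : ℕ} (hV : ∀ X ∈ V, X ^ H = 0) (hH : 1 ≤ H)
    {A : Matrix (Fin b) (Fin b) ℂ} (hA : A ∈ V) :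
    ∀ L : List (Matrix (Fin b) (Fin b) ℂ), (∀ B' ∈ L, B' ∈ V) → ∀ B ∈ V,
      A ^ (H - 1) * B * (L.map fun B' => A ^ (H - 2) * B').prod * A ^ (H - 1) = 0 := by
  intro L
  induction L with
  | nil =>
    intro _ B hB
    rw [List.map_nil, List.prod_nil, Matrix.mul_one]
    exact sandwich_eq_zero V hV hH hA hB
  | cons B' L ih =>
    intro hL B hB
    have hB' : B' ∈ V := hL B' List.mem_cons_self
    have hL' : ∀ X ∈ L, X ∈ V := fun X hX => hL X (List.mem_cons_of_mem _ hX)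
    rw [List.map_cons, List.prod_cons]
    set T := (L.map fun B'' => A ^ (H - 2) * B'').prod with hT
    have key : (∑ i ∈ Finset.range H, A ^ i * B * A ^ (H - 1 - i)) * (A ^ (H - 2) * B' * T * A ^ (H - 1)) = 0 := by
      rw [oneLetter_eq_zero V hV hA hB, Matrix.zero_mul]
    rw [Finset.sum_mul, Finset.sum_eq_single (H - 1)] at key
    · simpa [Matrix.mul_assoc] using key
    · intro i hi hne
      have hi' := Finset.mem_range.mp hi
      have e : H - 1 - i + (H - 2) = (H - 2 - i) + (H - 1) := by omega
      have e2 : A ^ (H - 1 - i) * A ^ (H - 2) = A ^ (H - 2 - i) * A ^ (H - 1) := by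
        rw [← pow_add, ← pow_add, e]
      calc A ^ i * B * A ^ (H - 1 - i) * (A ^ (H - 2) * B' * T * A ^ (H - 1))
          = A ^ i * B * (A ^ (H - 1 - i) * A ^ (H - 2)) * B' * T * A ^ (H - 1) := by
            simp only [Matrix.mul_assoc]
        _ = A ^ i * B * (A ^ (H - 2 - i) * A ^ (H - 1)) * B' * T * A ^ (H - 1) := by rw [e2]
        _ = A ^ i * B * A ^ (H - 2 - i) * (A ^ (H - 1) * B' * T * A ^ (H - 1)) := by
            simp only [Matrix.mul_assoc]
        _ = 0 := by rw [ih hL' B' hB', Matrix.mul_zero]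
    · intro hn
      exact absurd (Finset.mem_range.mpr (by omega)) hn

/-- The chain sandwich with the chain indexed by `Fin q`. -/
theorem chain_sandwich_eq_zero_fin (V : Submodule ℂ (Matrix (Fin b) (Fin b) ℂ)) {H : ℕ} (hV : ∀ X ∈ V, X ^ H = 0) (hH : 1 ≤ H)
    {A B : Matrix (Fin b) (Fin b) ℂ} (hA : A ∈ V) (hB : B ∈ V) {q : ℕ} (Bs : Fin q → Matrix (Fin b) (Fin b) ℂ)
    (hBs : ∀ l, Bs l ∈ V) :
    A ^ (H - 1) * B * (List.ofFn fun l => A ^ (H - 2) * Bs l).prod * A ^ (H - 1) = 0 := by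
  have h := chain_sandwich_eq_zero V hV hH hA (List.ofFn Bs) (fun B' hB' => ?_) B hB
  · rw [List.map_ofFn] at h
    exact h
  · obtain ⟨l, hl⟩ := List.mem_ofFn.mp hB'
    rw [← hl]
    exact hBs l

/-! ## §3 Index two: `A · Alg(V) · A = 0` -/

/-- ★★ **SQUARE-ZERO SPACES.**  If `X² = 0` for every `X ∈ V`, then `A · X · A = 0` for every `A ∈ V` and every `X` in the unital algebra
generated by `V`. -/
theorem sq_zero_space_sandwich (V : Submodule ℂ (Matrix (Fin b) (Fin b) ℂ)) (hV : ∀ X ∈ V, X ^ 2 = 0)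
    {A : Matrix (Fin b) (Fin b) ℂ} (hA : A ∈ V) :
    ∀ X ∈ Algebra.adjoin ℂ (V : Set (Matrix (Fin b) (Fin b) ℂ)), A * X * A = 0 := by
  intro X hX
  have hX' : X ∈ Subalgebra.toSubmodule (Algebra.adjoin ℂ (V : Set (Matrix (Fin b) (Fin b) ℂ))) := hX
  rw [Algebra.adjoin_eq_span] at hX'
  refine Submodule.span_induction ?_ ?_ ?_ ?_ hX'
  · intro Y hY
    obtain ⟨L, hL, rfl⟩ := Submonoid.exists_list_of_mem_closure hY
    cases L with
    | nil =>
      rw [List.prod_nil, Matrix.mul_one, ← pow_two]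
      exact hV A hA
    | cons B L =>
      have hB : B ∈ V := hL B List.mem_cons_self
      have hL' : ∀ Y ∈ L, Y ∈ V := fun Y hY => hL Y (List.mem_cons_of_mem _ hY)
      have h := chain_sandwich_eq_zero V hV (by norm_num) hA L hL' B hB
      have hmap : (L.map fun B' => A ^ (2 - 2) * B') = L := by simp
      rw [hmap] at h
      rw [List.prod_cons, ← Matrix.mul_assoc]
      simpa using h
  · rw [Matrix.mul_zero, Matrix.zero_mul]
  · intro Y Z _ _ hY hZ
    rw [Matrix.mul_add, Matrix.add_mul, hY, hZ, add_zero]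
  · intro c Y _ hY
    rw [Matrix.mul_smul, Matrix.smul_mul, hY, smul_zero]

/-- ★ Hence a square-zero space generating the FULL matrix algebra is `{0}`: an irreducible constituent (`Alg(V) = M_b(ℂ)`) never has index `2`. -/
theorem eq_zero_of_sq_zero_of_adjoin_eq_top (V : Submodule ℂ (Matrix (Fin b) (Fin b) ℂ)) (hV : ∀ X ∈ V, X ^ 2 = 0)
    (htop : Algebra.adjoin ℂ (V : Set (Matrix (Fin b) (Fin b) ℂ)) = ⊤)
    {A : Matrix (Fin b) (Fin b) ℂ} (hA : A ∈ V) : A = 0 := by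
  have h : ∀ X : Matrix (Fin b) (Fin b) ℂ, A * X * A = 0 := fun X =>
    sq_zero_space_sandwich V hV hA X (by rw [htop]; exact Algebra.mem_top)
  refine Matrix.ext fun i j => ?_
  -- `A_{ij} · A_{ij} = (A · E_{ji} · A)_{ij} = 0`
  have h1 := congr_fun (congr_fun (h (Matrix.single j i (1 : ℂ))) i) j
  rw [Matrix.mul_assoc, Matrix.mul_apply, Matrix.zero_apply] at h1
  have h2 : (∑ k, A i k * (Matrix.single j i (1 : ℂ) * A) k j) = A i j * A i j := by
    rw [Finset.sum_eq_single j]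
    · rw [Matrix.single_mul_apply_same, one_mul]
    · intro k _ hk
      rw [Matrix.single_mul_apply_of_ne (1 : ℂ) j i k j hk A, mul_zero]
    · intro hj
      exact absurd (Finset.mem_univ j) hj
  rw [h2] at h1
  rw [Matrix.zero_apply]
  exact mul_self_eq_zero.mp h1

/-! ## §4 Pencil currency -/

variable {n m : ℕ}

/-- Powers of point values: `N ^ H = 0 ⇒ N(x) ^ H = 0`. -/
theorem pointMat_pow_eq_zero_of_pow_eq_zero (N : AffMat n m) {H : ℕ} (hnil : N ^ H = 0) (x : Fin n × Fin n → ℂ) :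
    (pointMat N x) ^ H = 0 := by
  rw [pointMat, ← Matrix.map_pow N (MvPolynomial.eval x : MvPolynomial (Fin n × Fin n) ℂ →+* ℂ) H]
  change (N ^ H).map (MvPolynomial.eval x) = 0
  simp [hnil]

/-- The affine line through `x` in direction `v`: `N(x + t v) = N(x) + t · lin(v)`. -/
theorem pointMat_add_smul (N : AffMat n m) (hN : IsAffine N) (x v : Fin n × Fin n → ℂ) (t : ℂ) :
    pointMat N (x + t • v) = pointMat N x + t • linMat N v := by
  rw [pointMat_eq_pointMat_zero_add_linMat N hN (x + t • v), pointMat_eq_pointMat_zero_add_linMat N hN x, add_assoc]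
  congr 1
  rw [← linMap_apply, ← linMap_apply, ← linMap_apply, map_add, map_smul]

/-- The direction space consists of nilpotent matrices of index `≤ H`: `N ^ H = 0 ⇒ lin(v) ^ H = 0`. -/
theorem linMat_pow_eq_zero_of_pow_eq_zero (N : AffMat n m) (hN : IsAffine N) {H : ℕ} (hnil : N ^ H = 0)
    (v : Fin n × Fin n → ℂ) : (linMat N v) ^ H = 0 :=
  pow_eq_zero_of_forall_line_pow_eq_zero (pointMat N 0) (linMat N v) H fun t => by
    rw [← pointMat_add_smul N hN 0 v t]; exact pointMat_pow_eq_zero_of_pow_eq_zero N hnil _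

/-- The LINEAR SPAN of the point values of an affine pencil with `N ^ H = 0` is a nilpotent space of uniform index `≤ H`
(its members are `c·N(0) + lin(u)`: for `c ≠ 0` this is `c·N(c⁻¹u)`, for `c = 0` a direction). -/
theorem pow_eq_zero_of_mem_span_pointMat (N : AffMat n m) (hN : IsAffine N) {H : ℕ} (hnil : N ^ H = 0)
    {X : Matrix (Fin m) (Fin m) ℂ} (hX : X ∈ Submodule.span ℂ (Set.range (pointMat N))) : X ^ H = 0 := by
  have hrepr : ∃ (c : ℂ) (u : Fin n × Fin n → ℂ), X = c • pointMat N 0 + linMat N u := by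
    refine Submodule.span_induction ?_ ?_ ?_ ?_ hX
    · rintro _ ⟨y, rfl⟩
      exact ⟨1, y, by rw [one_smul, pointMat_eq_pointMat_zero_add_linMat N hN y]⟩
    · exact ⟨0, 0, by rw [zero_smul, zero_add, ← linMap_apply, map_zero]⟩
    · rintro _ _ _ _ ⟨c₁, u₁, rfl⟩ ⟨c₂, u₂, rfl⟩
      refine ⟨c₁ + c₂, u₁ + u₂, ?_⟩
      rw [← linMap_apply, ← linMap_apply, ← linMap_apply, map_add, add_smul]
      abel
    · rintro a _ _ ⟨c, u, rfl⟩
      refine ⟨a * c, a • u, ?_⟩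
      rw [← linMap_apply, ← linMap_apply, map_smul, smul_add, smul_smul]
  obtain ⟨c, u, rfl⟩ := hrepr
  by_cases hc : c = 0
  · rw [hc, zero_smul, zero_add]
    exact linMat_pow_eq_zero_of_pow_eq_zero N hN hnil u
  · have hX : c • pointMat N 0 + linMat N u = c • pointMat N (c⁻¹ • u) := by
      rw [pointMat_eq_pointMat_zero_add_linMat N hN (c⁻¹ • u), smul_add, ← linMap_apply, ← linMap_apply, map_smul,
        smul_smul, mul_inv_cancel₀ hc, one_smul]
    rw [hX, _root_.smul_pow, pointMat_pow_eq_zero_of_pow_eq_zero N hnil, smul_zero]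

/-- ★ **SANDWICH, PENCIL CURRENCY.**  For an affine pencil `N` with `N ^ H = 0` (`1 ≤ H`): `N(x)^{H−1} · lin(v) · N(x)^{H−1} = 0` at every point
`x` and along every direction `v`. -/
theorem pointMat_sandwich_linMat (N : AffMat n m) (hN : IsAffine N) {H : ℕ} (hnil : N ^ H = 0) (hH : 1 ≤ H)
    (x v : Fin n × Fin n → ℂ) :
    (pointMat N x) ^ (H - 1) * linMat N v * (pointMat N x) ^ (H - 1) = 0 := by
  set V : Submodule ℂ (Matrix (Fin m) (Fin m) ℂ) := Submodule.span ℂ (Set.range (pointMat N)) with hV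
  have hVnil : ∀ X ∈ V, X ^ H = 0 := fun X hX => pow_eq_zero_of_mem_span_pointMat N hN hnil hX
  have hmemx : pointMat N x ∈ V := Submodule.subset_span ⟨x, rfl⟩
  have hlin : linMat N v ∈ V := by
    have h1 : linMat N v = pointMat N v - pointMat N 0 := by
      rw [pointMat_eq_pointMat_zero_add_linMat N hN v]; abel
    rw [h1]
    exact V.sub_mem (Submodule.subset_span ⟨v, rfl⟩) (Submodule.subset_span ⟨0, rfl⟩)
  exact sandwich_eq_zero V hVnil hH hmemx hlin

/-- ★ **CHAIN SANDWICH, PENCIL CURRENCY.**  For an affine pencil `N` with `N ^ H = 0` (`1 ≤ H`), a point `x` and directions `v, w₁, …, w_q`: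
`N(x)^{H−1} · lin(v) · (N(x)^{H−2} lin(w₁)) ⋯ (N(x)^{H−2} lin(w_q)) · N(x)^{H−1} = 0`. -/
theorem pointMat_chain_sandwich (N : AffMat n m) (hN : IsAffine N) {H : ℕ} (hnil : N ^ H = 0) (hH : 1 ≤ H)
    (x v : Fin n × Fin n → ℂ) {q : ℕ} (w : Fin q → (Fin n × Fin n → ℂ)) :
    (pointMat N x) ^ (H - 1) * linMat N v * (List.ofFn fun l => (pointMat N x) ^ (H - 2) * linMat N (w l)).prod *
      (pointMat N x) ^ (H - 1) = 0 := by
  set V : Submodule ℂ (Matrix (Fin m) (Fin m) ℂ) := Submodule.span ℂ (Set.range (pointMat N)) with hV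
  have hVnil : ∀ X ∈ V, X ^ H = 0 := fun X hX => pow_eq_zero_of_mem_span_pointMat N hN hnil hX
  have hmemx : pointMat N x ∈ V := Submodule.subset_span ⟨x, rfl⟩
  have hlin : ∀ u, linMat N u ∈ V := by
    intro u
    have h1 : linMat N u = pointMat N u - pointMat N 0 := by
      rw [pointMat_eq_pointMat_zero_add_linMat N hN u]; abel
    rw [h1]
    exact V.sub_mem (Submodule.subset_span ⟨u, rfl⟩) (Submodule.subset_span ⟨0, rfl⟩)
  exact chain_sandwich_eq_zero_fin V hVnil hH hmemx (hlin v) (fun l => linMat N (w l)) fun l => hlin (w l)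

/-! ## §5 The chain sandwich in algebra form (appendix, same hand) -/

/-- ★★ **CHAIN SANDWICH, ALGEBRA FORM.**  In a nilpotent space `V` of uniform index `≤ H` (`1 ≤ H`), for `A, B ∈ V` and every `X` in the
unital algebra generated by `A^{H−2}·V = {A^{H−2}·B' : B' ∈ V}`: `A^{H−1} · B · X · A^{H−1} = 0`.  (For `H = 2` this is
`sq_zero_space_sandwich`; in words: every member of `V` maps the orbit of `range A^{H−1}` under the algebra of the operators `A^{H−2}B'`
into `ker A^{H−1}`.) -/
theorem chain_sandwich_adjoin (V : Submodule ℂ (Matrix (Fin b) (Fin b) ℂ)) {H : ℕ} (hV : ∀ X ∈ V, X ^ H = 0) (hH : 1 ≤ H)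
    {A B : Matrix (Fin b) (Fin b) ℂ} (hA : A ∈ V) (hB : B ∈ V) :
    ∀ X ∈ Algebra.adjoin ℂ ((fun B' : Matrix (Fin b) (Fin b) ℂ => A ^ (H - 2) * B') '' (V : Set (Matrix (Fin b) (Fin b) ℂ))),
      A ^ (H - 1) * B * X * A ^ (H - 1) = 0 := by
  intro X hX
  have hX' : X ∈ Subalgebra.toSubmodule
      (Algebra.adjoin ℂ ((fun B' : Matrix (Fin b) (Fin b) ℂ => A ^ (H - 2) * B') '' (V : Set (Matrix (Fin b) (Fin b) ℂ)))) := hX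
  rw [Algebra.adjoin_eq_span] at hX'
  refine Submodule.span_induction ?_ ?_ ?_ ?_ hX'
  · intro Y hY
    obtain ⟨L, hL, rfl⟩ := Submonoid.exists_list_of_mem_closure hY
    -- each factor is `A^{H−2}·B'` with `B' ∈ V`: choose the `B'`s
    have hchoice : ∀ Y ∈ L, ∃ B' ∈ V, Y = A ^ (H - 2) * B' := by
      intro Y hYL
      obtain ⟨B', hB', hYB⟩ := hL Y hYL
      exact ⟨B', hB', hYB.symm⟩
    choose f hf using hchoice
    have hLmap : L = (L.attach.map fun Y => f Y.1 Y.2).map fun B' => A ^ (H - 2) * B' := by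
      rw [List.map_map]
      conv_lhs => rw [← List.attach_map_subtype_val L]
      refine List.map_congr_left fun Y _ => ?_
      exact (hf Y.1 Y.2).2
    rw [hLmap, Matrix.mul_assoc (A ^ (H - 1) * B)]
    rw [← Matrix.mul_assoc (A ^ (H - 1) * B)]
    exact chain_sandwich_eq_zero V hV hH hA _ (fun B' hB' => by
      obtain ⟨Y, _, rfl⟩ := List.mem_map.mp hB'
      exact (hf Y.1 Y.2).1) B hB
  · rw [Matrix.mul_zero, Matrix.zero_mul]
  · intro Y Z _ _ hY hZ
    rw [Matrix.mul_add, Matrix.add_mul, hY, hZ, add_zero]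
  · intro c Y _ hY
    rw [Matrix.mul_smul, Matrix.smul_mul, hY, smul_zero]

end Summit.ValiantsHypothesis.ValiantsHypothesis.Theorems.GrenetZeon.NilSpaceSandwich

end
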